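import Mathlib
import Summits.MatrixMultiplication.MatrixMultiplication.Theorems.SnSubsetDichotomyNoThresholdSubsetTriplePlancherelGrowthDefs
import Summits.MatrixMultiplication.MatrixMultiplication.Theorems.SnSubsetDichotomyNoThresholdSubsetTripleShapeBeforeDefs

/-!
# Functions of two consecutive prefix shapes are measurable for the prefix filtration

Line `klr-graded-polynomial-method`, crux `SnSubsetDichotomy.NoThresholdSubsetTriple` (stmt-MatrixMultiplication-8302),
stub `stronglyMeasurable_prefix_pair` (MODEL theorem, measurability of the one-step increments): on the finite type
`TableauPair n` of same-shape pairs of standard Young tableaux (discrete σ-algebra) with the prefix filtration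
`ℱ_s = comap (prefixKey n s) ⊤` (tree `PlancherelGrowthDefs`), every function
`ω ↦ h (ν_t ω) (ν_{t+1} ω)` of the two consecutive prefix shapes `ν_s ω = shapeBefore (ω.2.2).1 s` (the cells of the
entries `< s` of the second tableau) is strongly `ℱ_{t+1}`-measurable.  Both shapes factor through the key at time
`t + 1`: for `s ≤ t + 1`, `shapeBefore (ω.2.2).1 s = ⋃_{k < s} (prefixKey n (t+1) ω k).toFinset`, and any function of
the key is `comap`-measurable (same argument as the third conjunct of the tree theorem `pairMeasure_basic`).
-/

open MeasureTheory
open Literature.RepresentationTheory.FiniteGroups (TableauPair)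

set_option linter.dupNamespace false in
/-- The registered stub signature spells Mathlib's scoped notation `StronglyMeasurable[m] f` (strong measurability of `f`
with respect to the σ-algebra `m`) with its namespace prefix, `MeasureTheory.StronglyMeasurable[m] f`; this local notation
makes that spelling parse, with the same expansion `@MeasureTheory.StronglyMeasurable _ _ _ m` as Mathlib's. -/
local notation "MeasureTheory.StronglyMeasurable[" m "]" => @MeasureTheory.StronglyMeasurable _ _ _ m

namespace Summit.MatrixMultiplication.MatrixMultiplication.Theorems

open PlancherelStep PlancherelGrowth

-- adapted from the private lemma `measurable_comap_top_comp` of the tree file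
-- `SnSubsetDichotomyNoThresholdSubsetTriplePairMeasureBasic.lean`
set_option linter.dupNamespace false in
/-- Any function factoring through `g` is measurable for the σ-algebra `comap g ⊤` generated by `g`
(the preimage of `s` under `F ∘ g` is the `g`-preimage of the (`⊤`-measurable) set `F ⁻¹' s`). -/
private theorem prefixPair_measurable_comap_top_comp {α β γ : Type*} [MeasurableSpace γ] (g : α → β)
    (F : β → γ) : Measurable[MeasurableSpace.comap g ⊤] (F ∘ g) := by
  intro s _
  exact MeasurableSpace.measurableSet_comap.2 ⟨F ⁻¹' s, MeasurableSpace.measurableSet_top, rfl⟩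

set_option linter.dupNamespace false in
/-- An earlier prefix shape is a function of a later prefix key: for `s ≤ t`, the cells of the entries `< s` of the
second tableau are the values `some _` of `prefixKey n t ω` at the indices `< s`. -/
private theorem shapeBefore_eq_biUnion_prefixKey_of_le {n s t : ℕ} (hst : s ≤ t) (ω : TableauPair n) :
    shapeBefore (ω.2.2).1 s =
      (Finset.univ.filter fun k : Fin n => k.1 < s).biUnion fun k => (prefixKey n t ω k).toFinset := by
  ext x
  simp only [shapeBefore, Finset.mem_image, Finset.mem_filter, Finset.mem_univ, true_and, Finset.mem_biUnion,
    Option.mem_toFinset, Option.mem_def, prefixKey]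
  constructor
  · rintro ⟨j, hj, rfl⟩
    exact ⟨j, hj, by rw [if_pos (lt_of_lt_of_le hj hst)]⟩
  · rintro ⟨j, hj, hx⟩
    rw [if_pos (lt_of_lt_of_le hj hst)] at hx
    exact ⟨j, hj, Option.some.inj hx⟩

set_option linter.dupNamespace false in
/-- **Functions of two consecutive prefix shapes are `ℱ_{t+1}`-strongly measurable** (stub
`stronglyMeasurable_prefix_pair` of line `klr-graded-polynomial-method`, crux `SnSubsetDichotomy.NoThresholdSubsetTriple`;
MODEL theorem, measurability of the one-step increments of the Plancherel growth).  For every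
`h : Finset (ℕ × ℕ) → Finset (ℕ × ℕ) → ℝ`, the function `ω ↦ h (shapeBefore (ω.2.2).1 t) (shapeBefore (ω.2.2).1 (t+1))`
of the prefix shapes of the second tableau at times `t` and `t + 1` is strongly measurable for the prefix σ-algebra
`prefixFiltration n (t + 1) = comap (prefixKey n (t + 1)) ⊤`: both shapes factor through the key at time `t + 1`,
and a (measurable) function of the key into `ℝ` is strongly measurable. -/
theorem stronglyMeasurable_prefix_pair : ∀ (n t : ℕ) (h : Finset (ℕ × ℕ) → Finset (ℕ × ℕ) → ℝ), MeasureTheory.StronglyMeasurable[PlancherelGrowth.prefixFiltration n (t + 1)] (fun ω : Literature.RepresentationTheory.FiniteGroups.TableauPair n => h (PlancherelStep.shapeBefore (ω.2.2).1 t) (PlancherelStep.shapeBefore (ω.2.2).1 (t + 1))) := by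
  intro n t h
  have hfac : (fun ω : TableauPair n => h (shapeBefore (ω.2.2).1 t) (shapeBefore (ω.2.2).1 (t + 1))) =
      (fun κ : Fin n → Option (ℕ × ℕ) =>
        h ((Finset.univ.filter fun k : Fin n => k.1 < t).biUnion fun k => (κ k).toFinset)
          ((Finset.univ.filter fun k : Fin n => k.1 < t + 1).biUnion fun k => (κ k).toFinset)) ∘
        prefixKey n (t + 1) := by
    funext ω
    rw [Function.comp_apply, shapeBefore_eq_biUnion_prefixKey_of_le (Nat.le_succ t) ω,
      shapeBefore_eq_biUnion_prefixKey_of_le le_rfl ω]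
  rw [hfac]
  exact (prefixPair_measurable_comap_top_comp (prefixKey n (t + 1)) _).stronglyMeasurable

end Summit.MatrixMultiplication.MatrixMultiplication.Theorems
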